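import Summits.RiemannHypothesis.RiemannHypothesis.Theorems.WeilWindowFlowWindowLipschitzStubCommutatorBoundAux

/-!
# Toolkit II for stub `stub_commutatorBound` (E) of line `cut-dont-squeeze`, crux `WeilWindowFlow.WindowLipschitz`
(item stmt-RiemannHypothesis-1039)

The archimedean commutator term `∫₀^∞ ρ(t) ∫ (χ(x+t) − χ(x))² |u(x+t)| |u(x)| dx dt` of the IMS
localisation error, for a window function `u` (zero off `[-a, a]`) cut by an admissible cutoff
`χ` of width `h`:

* `stub_commutatorBound_pointwise`: the pointwise majorant
  `ρ(t)(χ(x+t) − χ(x))²|u(x+t)||u(x)| ≤ c(t)(g(x) + g(x+t)) + V(x) f(x+t) + f(x) V(x+t)`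
  (`c = 1_{(0,4h]} ρ(t) t²/(2h²)`, `g ≥ |u|² 1_{depth<6h}`, `f ≥ |u| 1_{depth<2h}`): near jumps
  `t ≤ 4h` see only the edge layer of depth `6h`, far jumps have one end in the layer of depth `2h`
  and `ρ(t) ≤ W` at the other end (depth is `1`-Lipschitz);
* `stub_commutatorBound_arch_le`: integrating such a majorant (Tonelli for the correlation terms,
  in `ℝ≥0∞`, so that no integrability of the left-hand side is needed):
  `∫₀^∞ ρ(t) ∫ K(t,x) dx dt ≤ 2 (∫ c)(∫ g) + 2 (∫ V)(∫ f)`;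
* `stub_commutatorBound_integral_c_le`: `∫ c ≤ 8`.

Sources: line card `Lines/cut-dont-squeeze.md` §Stub E; Cycon–Froese–Kirsch–Simon, *Schrödinger
Operators*, Thm. 3.2 (IMS localisation formula).
-/

set_option linter.dupNamespace false

noncomputable section

open MeasureTheory Set Filter
open scoped Topology ENNReal NNReal

namespace Summit.RiemannHypothesis.RiemannHypothesis.Theorems.WeilWindowFlowWindowLipschitz

open Literature.NumberTheory.LFunctions

/-! ## Integrating a correlation majorant -/

/-- **The archimedean term against a correlation majorant.** If a non-negative kernel satisfies
`ρ(t) K(t, x) ≤ c(t) (g(x) + g(x+t)) + V(x) f(x+t) + f(x) V(x+t)` for `t > 0`, with `c, f, g, V`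
non-negative, measurable and integrable, then
`∫_{t>0} ρ(t) ∫ K(t,x) dx dt ≤ 2 (∫ c)(∫ g) + 2 (∫ V)(∫ f)`.
Everything is moved to `ℝ≥0∞` (`ofReal ∫ ≤ ∫⁻ ofReal`, so the left side needs no integrability),
where the correlation terms are computed by Tonelli and translation invariance
(`stub_commutatorBound_lintegral_correlation`). -/
theorem stub_commutatorBound_arch_le {ρ c f g V : ℝ → ℝ} {Kf : ℝ → ℝ → ℝ}
    (hcm : Measurable c) (hfm : Measurable f) (hgm : Measurable g) (hVm : Measurable V)
    (hc0 : ∀ t, 0 ≤ c t) (hf0 : ∀ x, 0 ≤ f x) (hg0 : ∀ x, 0 ≤ g x) (hV0 : ∀ x, 0 ≤ V x)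
    (hci : Integrable c) (hfi : Integrable f) (hgi : Integrable g) (hVi : Integrable V)
    (hbound : ∀ t, 0 < t → ∀ x,
      ρ t * Kf t x ≤ c t * (g x + g (x + t)) + V x * f (x + t) + f x * V (x + t)) :
    ∫ t in Ioi 0, ρ t * ∫ x, Kf t x ≤
      2 * (∫ t, c t) * (∫ x, g x) + 2 * (∫ x, V x) * (∫ x, f x) := by
  -- `ofReal ∫ ≤ ∫⁻ ofReal` (junk value `0` included)
  have hofReal : ∀ (μ : Measure ℝ) (F : ℝ → ℝ),
      ENNReal.ofReal (∫ x, F x ∂μ) ≤ ∫⁻ x, ENNReal.ofReal (F x) ∂μ := by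
    intro μ F
    by_cases hF : Integrable F μ
    · calc ENNReal.ofReal (∫ x, F x ∂μ) ≤ ENNReal.ofReal (∫ x, max (F x) 0 ∂μ) :=
            ENNReal.ofReal_le_ofReal (integral_mono hF hF.pos_part fun x ↦ le_max_left _ _)
        _ = ∫⁻ x, ENNReal.ofReal (max (F x) 0) ∂μ :=
            ofReal_integral_eq_lintegral_ofReal hF.pos_part
              (Eventually.of_forall fun x ↦ le_max_right _ _)
        _ = ∫⁻ x, ENNReal.ofReal (F x) ∂μ := lintegral_congr fun x ↦ by simp
    · rw [integral_undef hF, ENNReal.ofReal_zero]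
      exact bot_le
  -- the four integrals in `ℝ≥0∞`
  have hIc : ∫⁻ t, ENNReal.ofReal (c t) = ENNReal.ofReal (∫ t, c t) :=
    (ofReal_integral_eq_lintegral_ofReal hci (Eventually.of_forall hc0)).symm
  have hIg : ∫⁻ x, ENNReal.ofReal (g x) = ENNReal.ofReal (∫ x, g x) :=
    (ofReal_integral_eq_lintegral_ofReal hgi (Eventually.of_forall hg0)).symm
  have hIf : ∫⁻ x, ENNReal.ofReal (f x) = ENNReal.ofReal (∫ x, f x) :=
    (ofReal_integral_eq_lintegral_ofReal hfi (Eventually.of_forall hf0)).symm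
  have hIV : ∫⁻ x, ENNReal.ofReal (V x) = ENNReal.ofReal (∫ x, V x) :=
    (ofReal_integral_eq_lintegral_ofReal hVi (Eventually.of_forall hV0)).symm
  have hcE : Measurable fun t ↦ ENNReal.ofReal (c t) := hcm.ennreal_ofReal
  have hfE : Measurable fun x ↦ ENNReal.ofReal (f x) := hfm.ennreal_ofReal
  have hgE : Measurable fun x ↦ ENNReal.ofReal (g x) := hgm.ennreal_ofReal
  have hVE : Measurable fun x ↦ ENNReal.ofReal (V x) := hVm.ennreal_ofReal
  -- Step 1: the inner integral, for fixed `t > 0`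
  have hstep : ∀ t, 0 < t → ENNReal.ofReal (ρ t * ∫ x, Kf t x) ≤
      ENNReal.ofReal (c t) * (2 * ENNReal.ofReal (∫ x, g x)) +
        ((∫⁻ x, ENNReal.ofReal (V x) * ENNReal.ofReal (f (x + t))) +
          ∫⁻ x, ENNReal.ofReal (f x) * ENNReal.ofReal (V (x + t))) := by
    intro t ht
    have hm1 : Measurable fun x ↦ ENNReal.ofReal (c t) *
        (ENNReal.ofReal (g x) + ENNReal.ofReal (g (x + t))) :=
      measurable_const.mul (hgE.add (hgE.comp (measurable_id.add_const t)))
    have hm2 : Measurable fun x ↦ ENNReal.ofReal (V x) * ENNReal.ofReal (f (x + t)) :=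
      hVE.mul (hfE.comp (measurable_id.add_const t))
    have hgt : Measurable fun x ↦ ENNReal.ofReal (g (x + t)) :=
      hgE.comp (measurable_id.add_const t)
    calc ENNReal.ofReal (ρ t * ∫ x, Kf t x)
        = ENNReal.ofReal (∫ x, ρ t * Kf t x) := by rw [integral_const_mul]
      _ ≤ ∫⁻ x, ENNReal.ofReal (ρ t * Kf t x) := hofReal _ _
      _ ≤ ∫⁻ x, (ENNReal.ofReal (c t) * (ENNReal.ofReal (g x) + ENNReal.ofReal (g (x + t))) +
            (ENNReal.ofReal (V x) * ENNReal.ofReal (f (x + t)) +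
              ENNReal.ofReal (f x) * ENNReal.ofReal (V (x + t)))) := by
          refine lintegral_mono fun x ↦ ?_
          rw [← ENNReal.ofReal_add (hg0 _) (hg0 _), ← ENNReal.ofReal_mul (hc0 _),
            ← ENNReal.ofReal_mul (hV0 _), ← ENNReal.ofReal_mul (hf0 _),
            ← ENNReal.ofReal_add (mul_nonneg (hV0 _) (hf0 _)) (mul_nonneg (hf0 _) (hV0 _)),
            ← ENNReal.ofReal_add (mul_nonneg (hc0 _) (add_nonneg (hg0 _) (hg0 _)))
              (add_nonneg (mul_nonneg (hV0 _) (hf0 _)) (mul_nonneg (hf0 _) (hV0 _)))]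
          exact ENNReal.ofReal_le_ofReal (by linarith [hbound t ht x])
      _ = ENNReal.ofReal (c t) * ((∫⁻ x, ENNReal.ofReal (g x)) + ∫⁻ x, ENNReal.ofReal (g (x + t))) +
            ((∫⁻ x, ENNReal.ofReal (V x) * ENNReal.ofReal (f (x + t))) +
              ∫⁻ x, ENNReal.ofReal (f x) * ENNReal.ofReal (V (x + t))) := by
          have hgg : Measurable fun x ↦ ENNReal.ofReal (g x) + ENNReal.ofReal (g (x + t)) :=
            hgE.add hgt
          rw [lintegral_add_left hm1, lintegral_add_left hm2, lintegral_const_mul _ hgg,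
            lintegral_add_left hgE]
      _ = _ := by
          rw [lintegral_add_right_eq_self (fun x ↦ ENNReal.ofReal (g x)) t, hIg, two_mul]
  -- Step 2: integrate in `t`
  have hP₂ : Measurable fun t ↦ ∫⁻ x, ENNReal.ofReal (V x) * ENNReal.ofReal (f (x + t)) :=
    Measurable.lintegral_prod_right
      ((hVE.comp measurable_snd).mul (hfE.comp (measurable_snd.add measurable_fst)))
  have hP₁ : Measurable fun t ↦ ENNReal.ofReal (c t) * (2 * ENNReal.ofReal (∫ x, g x)) :=
    hcE.mul measurable_const
  have hmain : ENNReal.ofReal (∫ t in Ioi 0, ρ t * ∫ x, Kf t x) ≤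
      ENNReal.ofReal (2 * (∫ t, c t) * (∫ x, g x) + 2 * (∫ x, V x) * (∫ x, f x)) := by
    calc ENNReal.ofReal (∫ t in Ioi 0, ρ t * ∫ x, Kf t x)
        ≤ ∫⁻ t in Ioi 0, ENNReal.ofReal (ρ t * ∫ x, Kf t x) := hofReal _ _
      _ ≤ ∫⁻ t in Ioi 0, (ENNReal.ofReal (c t) * (2 * ENNReal.ofReal (∫ x, g x)) +
            ((∫⁻ x, ENNReal.ofReal (V x) * ENNReal.ofReal (f (x + t))) +
              ∫⁻ x, ENNReal.ofReal (f x) * ENNReal.ofReal (V (x + t)))) :=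
          lintegral_mono_ae ((ae_restrict_iff' measurableSet_Ioi).2 (Eventually.of_forall hstep))
      _ ≤ ∫⁻ t, (ENNReal.ofReal (c t) * (2 * ENNReal.ofReal (∫ x, g x)) +
            ((∫⁻ x, ENNReal.ofReal (V x) * ENNReal.ofReal (f (x + t))) +
              ∫⁻ x, ENNReal.ofReal (f x) * ENNReal.ofReal (V (x + t)))) :=
          setLIntegral_le_lintegral _ _
      _ = (∫⁻ t, ENNReal.ofReal (c t)) * (2 * ENNReal.ofReal (∫ x, g x)) +
            ((∫⁻ x, ENNReal.ofReal (V x)) * (∫⁻ x, ENNReal.ofReal (f x)) +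
              (∫⁻ x, ENNReal.ofReal (f x)) * ∫⁻ x, ENNReal.ofReal (V x)) := by
          rw [lintegral_add_left hP₁, lintegral_add_left hP₂, lintegral_mul_const _ hcE,
            stub_commutatorBound_lintegral_correlation hVE hfE,
            stub_commutatorBound_lintegral_correlation hfE hVE]
      _ = ENNReal.ofReal (2 * (∫ t, c t) * (∫ x, g x) + 2 * (∫ x, V x) * (∫ x, f x)) := by
          have h2 : (2 : ℝ≥0∞) = ENNReal.ofReal 2 := by simp
          have i1 : 0 ≤ ∫ t, c t := integral_nonneg hc0
          have i2 : 0 ≤ ∫ x, g x := integral_nonneg hg0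
          have i3 : 0 ≤ ∫ x, f x := integral_nonneg hf0
          have i4 : 0 ≤ ∫ x, V x := integral_nonneg hV0
          rw [hIc, hIf, hIV, h2, ← ENNReal.ofReal_mul (by norm_num),
            ← ENNReal.ofReal_mul i1, ← ENNReal.ofReal_mul i4, ← ENNReal.ofReal_mul i3,
            ← ENNReal.ofReal_add (mul_nonneg i4 i3) (mul_nonneg i3 i4),
            ← ENNReal.ofReal_add (mul_nonneg i1 (mul_nonneg (by norm_num) i2))
              (add_nonneg (mul_nonneg i4 i3) (mul_nonneg i3 i4))]
          congr 1
          ring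
  exact (ENNReal.ofReal_le_ofReal_iff (add_nonneg
    (mul_nonneg (mul_nonneg zero_le_two (integral_nonneg hc0)) (integral_nonneg hg0))
    (mul_nonneg (mul_nonneg zero_le_two (integral_nonneg hV0)) (integral_nonneg hf0)))).1 hmain

/-! ## The pointwise majorant -/

/-- **Pointwise majorant of the archimedean integrand.** For an admissible cutoff `χ` (values in
`[0,1]`, slope `≤ 1/h`, `= 1` at depth `a − |x| ≥ 2h`), a window function `u` (zero off `[-a, a]`),
`f ≥ |u|` on the layer of depth `< 2h`, `g ≥ |u|²` on the layer of depth `< 6h`, and a weight `W`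
with `W ≥ ρ(4h)` at depth `< 4h` and `W(x) ≥ ρ((a − |x|)/2)` at depth `≥ 4h`: for `t > 0`,
`ρ(t)(χ(x+t) − χ x)² |u(x+t)| |u x| ≤ c(t)(g x + g(x+t)) + |u x| W x · f(x+t) + f x · |u(x+t)| W(x+t)`,
`c = 1_{(0,4h]} ρ(t) (t/h)²/2`. Near jumps (`t ≤ 4h`): `(χ(x+t)−χ(x))² ≤ t²/h²`, AM–GM, and both
ends lie at depth `< 6h` (depth is `1`-Lipschitz). Far jumps: one end lies at depth `< 2h` and at
the other end `ρ(t) ≤ W` (`t ≥ 4h`, and `t ≥ depth − 2h ≥ depth/2`; `ρ` is decreasing). -/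
theorem stub_commutatorBound_pointwise {u : ℝ → ℂ} {χ f g W : ℝ → ℝ} {a h : ℝ} (hh : 0 < h)
    (hu0 : ∀ x, x ∉ Icc (-a) a → u x = 0)
    (hχlip : ∀ x y, |χ x - χ y| ≤ |x - y| / h) (hχ01 : ∀ x, 0 ≤ χ x ∧ χ x ≤ 1)
    (hχ1 : ∀ x, |x| ≤ a - 2 * h → χ x = 1)
    (hf0 : ∀ x, 0 ≤ f x) (hf : ∀ x, a - |x| < 2 * h → ‖u x‖ ≤ f x)
    (hg0 : ∀ x, 0 ≤ g x) (hg : ∀ x, a - |x| < 6 * h → ‖u x‖ ^ 2 ≤ g x)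
    (hW0 : ∀ x, 0 ≤ W x) (hW1 : ∀ x, a - |x| < 4 * h → weilArchDensity (4 * h) ≤ W x)
    (hW2 : ∀ x, 4 * h ≤ a - |x| → weilArchDensity ((a - |x|) / 2) ≤ W x)
    {t : ℝ} (ht : 0 < t) (x : ℝ) :
    weilArchDensity t * ((χ (x + t) - χ x) ^ 2 * (‖u (x + t)‖ * ‖u x‖)) ≤
      (Ioc 0 (4 * h)).indicator (fun t ↦ weilArchDensity t * (t / h) ^ 2 / 2) t *
          (g x + g (x + t)) +
        ‖u x‖ * W x * f (x + t) + f x * (‖u (x + t)‖ * W (x + t)) := by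
  have hρt : 0 ≤ weilArchDensity t := (weilArchDensity_pos ht).le
  have hc0 : 0 ≤ (Ioc 0 (4 * h)).indicator (fun t ↦ weilArchDensity t * (t / h) ^ 2 / 2) t :=
    indicator_nonneg (fun s hs ↦ by
      have := (weilArchDensity_pos hs.1).le
      positivity) t
  have hR1 : 0 ≤ (Ioc 0 (4 * h)).indicator (fun t ↦ weilArchDensity t * (t / h) ^ 2 / 2) t *
      (g x + g (x + t)) := mul_nonneg hc0 (add_nonneg (hg0 _) (hg0 _))
  have hR2 : 0 ≤ ‖u x‖ * W x * f (x + t) := by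
    have := hW0 x; have := hf0 (x + t); positivity
  have hR3 : 0 ≤ f x * (‖u (x + t)‖ * W (x + t)) := by
    have := hW0 (x + t); have := hf0 x; positivity
  -- trivial cases: one end outside the support
  by_cases hux : u x = 0
  · rw [hux, norm_zero, mul_zero, mul_zero, mul_zero]
    linarith
  by_cases huy : u (x + t) = 0
  · rw [huy, norm_zero, zero_mul, mul_zero, mul_zero]
    linarith
  have hxI : x ∈ Icc (-a) a := by
    by_contra hc
    exact hux (hu0 x hc)
  have hyI : x + t ∈ Icc (-a) a := by
    by_contra hc
    exact huy (hu0 _ hc)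
  have hxa : |x| ≤ a := abs_le.2 ⟨hxI.1, hxI.2⟩
  have hya : |x + t| ≤ a := abs_le.2 ⟨hyI.1, hyI.2⟩
  -- depth is 1-Lipschitz
  have hd1 : |x + t| - |x| ≤ t := by
    have h1 := abs_abs_sub_abs_le (x + t) x
    rw [add_sub_cancel_left, abs_of_pos ht] at h1
    exact (le_abs_self _).trans h1
  have hd2 : |x| - |x + t| ≤ t := by
    have h1 := abs_abs_sub_abs_le x (x + t)
    rw [sub_add_cancel_left, abs_neg, abs_of_pos ht] at h1
    exact (le_abs_self _).trans h1
  -- both ends deep: the cutoff is `1` at both ends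
  by_cases hfar : 2 * h ≤ a - |x| ∧ 2 * h ≤ a - |x + t|
  · rw [hχ1 x (by linarith [hfar.1]), hχ1 (x + t) (by linarith [hfar.2]), sub_self]
    simp only [ne_eq, OfNat.ofNat_ne_zero, not_false_eq_true, zero_pow, zero_mul, mul_zero]
    linarith
  have hsq1 : (χ (x + t) - χ x) ^ 2 ≤ 1 := by
    have h1 := hχ01 x
    have h2 := hχ01 (x + t)
    have hab : |χ (x + t) - χ x| ≤ 1 := abs_sub_le_iff.2 ⟨by linarith, by linarith⟩
    calc (χ (x + t) - χ x) ^ 2 = |χ (x + t) - χ x| ^ 2 := (sq_abs _).symm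
      _ ≤ 1 ^ 2 := pow_le_pow_left₀ (abs_nonneg _) hab 2
      _ = 1 := one_pow 2
  by_cases htn : t ≤ 4 * h
  · -- near jumps
    have hsq : (χ (x + t) - χ x) ^ 2 ≤ (t / h) ^ 2 := by
      have hab : |χ (x + t) - χ x| ≤ t / h := by
        have := hχlip (x + t) x
        rwa [add_sub_cancel_left, abs_of_pos ht] at this
      calc (χ (x + t) - χ x) ^ 2 = |χ (x + t) - χ x| ^ 2 := (sq_abs _).symm
        _ ≤ (t / h) ^ 2 := pow_le_pow_left₀ (abs_nonneg _) hab 2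
    have hgx : ‖u x‖ ^ 2 ≤ g x := hg x (by
      rcases not_and_or.1 hfar with h1 | h1 <;> linarith [not_le.1 h1])
    have hgy : ‖u (x + t)‖ ^ 2 ≤ g (x + t) := hg (x + t) (by
      rcases not_and_or.1 hfar with h1 | h1 <;> linarith [not_le.1 h1])
    have hamgm : ‖u (x + t)‖ * ‖u x‖ ≤ (‖u x‖ ^ 2 + ‖u (x + t)‖ ^ 2) / 2 := by
      nlinarith [sq_nonneg (‖u (x + t)‖ - ‖u x‖)]
    have hct : (Ioc 0 (4 * h)).indicator (fun t ↦ weilArchDensity t * (t / h) ^ 2 / 2) t =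
        weilArchDensity t * (t / h) ^ 2 / 2 :=
      indicator_of_mem (show t ∈ Ioc 0 (4 * h) from ⟨ht, htn⟩) _
    rw [hct]
    have hprod : 0 ≤ ‖u (x + t)‖ * ‖u x‖ := by positivity
    calc weilArchDensity t * ((χ (x + t) - χ x) ^ 2 * (‖u (x + t)‖ * ‖u x‖))
        ≤ weilArchDensity t * ((t / h) ^ 2 * ((‖u x‖ ^ 2 + ‖u (x + t)‖ ^ 2) / 2)) :=
          mul_le_mul_of_nonneg_left (mul_le_mul hsq hamgm hprod (by positivity)) hρt
      _ = weilArchDensity t * (t / h) ^ 2 / 2 * (‖u x‖ ^ 2 + ‖u (x + t)‖ ^ 2) := by ring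
      _ ≤ weilArchDensity t * (t / h) ^ 2 / 2 * (g x + g (x + t)) := by
          gcongr
      _ ≤ _ := by linarith
  · -- far jumps: `4h < t`
    have ht4 : 4 * h < t := not_le.1 htn
    have hbase : weilArchDensity t * ((χ (x + t) - χ x) ^ 2 * (‖u (x + t)‖ * ‖u x‖)) ≤
        weilArchDensity t * (‖u (x + t)‖ * ‖u x‖) := by
      have hprod : 0 ≤ ‖u (x + t)‖ * ‖u x‖ := by positivity
      calc _ ≤ weilArchDensity t * (1 * (‖u (x + t)‖ * ‖u x‖)) := by gcongr
        _ = _ := by rw [one_mul]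
    -- `ρ(t) ≤ W` at any end whose partner lies in the `2h`-layer
    have hWge : ∀ z z' : ℝ, |z| ≤ a → a - |z'| < 2 * h → |z'| - |z| ≤ t →
        weilArchDensity t ≤ W z := by
      intro z z' _ hz' hzz'
      by_cases hz4 : a - |z| < 4 * h
      · exact (weilArchDensity_antitoneOn (mem_Ioi.2 (by positivity)) (mem_Ioi.2 ht)
          ht4.le).trans (hW1 z hz4)
      · have hz4' : 4 * h ≤ a - |z| := not_lt.1 hz4
        refine (weilArchDensity_antitoneOn (mem_Ioi.2 (by linarith)) (mem_Ioi.2 ht)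
          ?_).trans (hW2 z hz4')
        linarith
    rcases not_and_or.1 hfar with hxL | hyL
    · -- `x` in the layer: bound by `f x * (|u(x+t)| W(x+t))`
      have hxL' : a - |x| < 2 * h := not_le.1 hxL
      have hW : weilArchDensity t ≤ W (x + t) := hWge (x + t) x hya hxL' hd2
      calc _ ≤ weilArchDensity t * (‖u (x + t)‖ * ‖u x‖) := hbase
        _ = ‖u x‖ * (‖u (x + t)‖ * weilArchDensity t) := by ring
        _ ≤ f x * (‖u (x + t)‖ * W (x + t)) :=
            mul_le_mul (hf x hxL') (mul_le_mul_of_nonneg_left hW (norm_nonneg _))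
              (by positivity) (hf0 x)
        _ ≤ _ := by linarith
    · -- `x + t` in the layer: bound by `(|u x| W x) * f(x+t)`
      have hyL' : a - |x + t| < 2 * h := not_le.1 hyL
      have hW : weilArchDensity t ≤ W x := hWge x (x + t) hxa hyL' hd1
      calc _ ≤ weilArchDensity t * (‖u (x + t)‖ * ‖u x‖) := hbase
        _ = ‖u x‖ * weilArchDensity t * ‖u (x + t)‖ := by ring
        _ ≤ ‖u x‖ * W x * f (x + t) :=
            mul_le_mul (mul_le_mul_of_nonneg_left hW (norm_nonneg _)) (hf _ hyL')
              (norm_nonneg _) (mul_nonneg (norm_nonneg _) (hW0 x))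
        _ ≤ _ := by linarith

/-- **The near-jump coefficient** `c = 1_{(0,4h]} ρ(t) (t/h)²/2` is non-negative, measurable,
integrable and `∫ c ≤ 8` (on `(0, 4h] ⊆ (0, 1]`, `ρ(t) ≤ 1/t`, so `c ≤ t/(2h²) ≤ 2/h`). -/
theorem stub_commutatorBound_integral_c_le :
    ∀ {h : ℝ}, 0 < h → 4 * h ≤ 1 →
      (∀ t, 0 ≤ (Ioc 0 (4 * h)).indicator (fun t ↦ weilArchDensity t * (t / h) ^ 2 / 2) t) ∧
      Measurable ((Ioc 0 (4 * h)).indicator (fun t ↦ weilArchDensity t * (t / h) ^ 2 / 2)) ∧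
      Integrable ((Ioc 0 (4 * h)).indicator (fun t ↦ weilArchDensity t * (t / h) ^ 2 / 2)) ∧
      ∫ t, (Ioc 0 (4 * h)).indicator (fun t ↦ weilArchDensity t * (t / h) ^ 2 / 2) t ≤ 8 := by
  intro h hh h41
  have hc0 : ∀ t, 0 ≤ (Ioc 0 (4 * h)).indicator (fun t ↦ weilArchDensity t * (t / h) ^ 2 / 2) t :=
    fun t ↦ indicator_nonneg (fun s hs ↦ by
      have := (weilArchDensity_pos hs.1).le
      positivity) t
  have hcm : Measurable ((Ioc 0 (4 * h)).indicator
      (fun t ↦ weilArchDensity t * (t / h) ^ 2 / 2)) :=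
    ((measurable_weilArchDensity.mul ((measurable_id.div_const h).pow_const 2)).div_const
      2).indicator measurableSet_Ioc
  have hbd : ∀ t, (Ioc 0 (4 * h)).indicator (fun t ↦ weilArchDensity t * (t / h) ^ 2 / 2) t ≤
      (Ioc 0 (4 * h)).indicator (fun _ ↦ 2 / h) t := by
    intro t
    by_cases hts : t ∈ Ioc 0 (4 * h)
    · rw [indicator_of_mem hts, indicator_of_mem hts]
      have ht1 : t ≤ 1 := hts.2.trans h41
      have hρ := stub_commutatorBound_rho_le_inv hts.1 ht1
      calc weilArchDensity t * (t / h) ^ 2 / 2 ≤ (1 / t) * (t / h) ^ 2 / 2 := by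
            gcongr
        _ = t / (2 * h ^ 2) := by field_simp
        _ ≤ (4 * h) / (2 * h ^ 2) := by gcongr; exact hts.2
        _ = 2 / h := by field_simp; ring
    · rw [indicator_of_notMem hts, indicator_of_notMem hts]
  have hgi : Integrable ((Ioc 0 (4 * h)).indicator fun _ : ℝ ↦ (2 / h : ℝ)) :=
    (integrable_indicator_iff measurableSet_Ioc).2 (integrableOn_const (hs := measure_Ioc_lt_top.ne))
  have hci : Integrable ((Ioc 0 (4 * h)).indicator
      (fun t ↦ weilArchDensity t * (t / h) ^ 2 / 2)) :=
    hgi.mono' hcm.aestronglyMeasurable (Eventually.of_forall fun t ↦ by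
      rw [Real.norm_of_nonneg (hc0 t)]
      exact hbd t)
  refine ⟨hc0, hcm, hci, ?_⟩
  calc ∫ t, (Ioc 0 (4 * h)).indicator (fun t ↦ weilArchDensity t * (t / h) ^ 2 / 2) t
      ≤ ∫ t, (Ioc 0 (4 * h)).indicator (fun _ ↦ (2 / h : ℝ)) t := integral_mono hci hgi hbd
    _ = 8 := by
        rw [integral_indicator_const _ measurableSet_Ioc, Real.volume_real_Ioc_of_le (by positivity),
          smul_eq_mul]
        field_simp
        ring

end Summit.RiemannHypothesis.RiemannHypothesis.Theorems.WeilWindowFlowWindowLipschitz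

end
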